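/-
Copyright (c) 2026. All rights reserved.
Released under Apache 2.0 license as described in the file LICENSE.
Authors: abc-iut cell, D-0079 R-W numerics crew seat abc-iut-W-num-6 (gen 0).
-/
import Literature.IUT.LogVolume.UnitLogMaxNorm
import HarnessLib

/-!
# The log envelope exponent is MONOTONE in the ramification index: a UNIFORM radius over `e ≤ E`

Proof-only arithmetic companion (no definitions, no named facts) of `UnitLogMaxNorm.lean` (abc-iut-c312-3: for a
`p`-adic field `K` with `e = absRamificationIdx p K` and turning index `a₀` — `p^a·(p−1) < e` for `a < a₀`, `e ≤ p^{a₀}·(p−1)` —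
every unit logarithm has norm `≤ ‖ϖ‖^{p^{a₀} − e·a₀} = p^{a₀ − p^{a₀}/e}`, `LogEnvelope.forall_mem_logUnits_norm_le_envelope`).

For the R-W «WINDOW Θ-SIDE INEQUALITY» numerics (HOME/plan/W/WINDOW-SPEC.md §2 (U2); W-num-6 RESULT 5 / RECIPE «RAD-UNIFORM») one
needs the envelope radius UNIFORMLY over all ramification indices `1 ≤ e ≤ E` (e.g. `E` = the print (R2) bound on `e_w`): the
log-exponent `a₀ − p^{a₀}/e` of the radius is bounded by the same expression at `E` with ITS turning index `S`,

  `a₀ − p^{a₀}/e ≤ S − p^S/E`   (`envelope_logExponent_le_of_le`),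

because on each cell `p^{s−1}(p−1) < e ≤ p^s(p−1)` the turning index is `s` and `s − p^s/e` increases with `e`, while across
cells `s − p^s/e ≤ s − 1/(p−1) < (s+1) − p/(p−1) < …`.  Consequently `p^{a₀ − p^{a₀}/e} ≤ p^{S − p^S/E}` (`rpow_envelope_le_of_le`),
so ONE real number serves as the radius `r` of abc-iut-w4-d026's
`Summit.ABC.IUTFork.Thm311.Real.not_licence_settingPrVolSharp_of_explicitDepth_star_radius` for every place with `e_w ≤ E`.
Also recorded: the elementary bound `logRadiusA p e < 1/(p−2) + 1/e` (`p > 2`) on [IUTchIV] Prop. 1.2's exponent `a = ⌈e/(p−2)⌉/e`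
(the tree has `a − 1/e ≤ 4/p`, `LogRadiusBounds.logRadiusA_sub_one_div_le`, which is weaker for `p ≥ 7`).

Classical arithmetic (Neukirch, *Algebraic Number Theory*, Ch. II (5.5) for the envelope); nothing here is disputed mathematics; no
IUT statement is asserted; nothing bears on [IUTchIII] Cor. 3.12. [cite: NeukirchANT1999, Ch. II (5.5)]
-/

noncomputable section

namespace Literature.IUT.LogVolume

namespace LogEnvelope

variable {p : ℕ} [hp : Fact p.Prime]

omit hp in
/-- **The turning index is monotone**: if `a₀` is the turning index of `e` and `S` that of `E ≥ e`, then `a₀ ≤ S`.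
[cite: NeukirchANT1999, Ch. II (5.5)] -/
theorem turning_le_turning_of_le {e E a₀ S : ℕ} (hE : e ≤ E)
    (hlo : ∀ a < a₀, (p : ℤ) ^ a * ((p : ℤ) - 1) < e)
    (hhiS : (E : ℤ) ≤ (p : ℤ) ^ S * ((p : ℤ) - 1)) : a₀ ≤ S := by
  by_contra h
  have hlt : S < a₀ := Nat.lt_of_not_le h
  have h1 := hlo S hlt
  have h2 : (e : ℤ) ≤ E := by exact_mod_cast hE
  omega

/-- **Uniform envelope exponent**: for `1 ≤ e ≤ E` with turning indices `a₀` (of `e`) and `S` (of `E`),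
`a₀ − p^{a₀}/e ≤ S − p^S/E`.  On the common cell `a₀ = S` this is `p^S/E ≤ p^S/e`; below it, `p^{a₀}/e ≥ 1/(p−1)` (from
`e ≤ p^{a₀}(p−1)`) and `p^S/E < p/(p−1)` (from `p^{S−1}(p−1) < E`) give `a₀ − p^{a₀}/e ≤ S − 1 − 1/(p−1) < S − p^S/E`.
[cite: NeukirchANT1999, Ch. II (5.5)] -/
theorem envelope_logExponent_le_of_le {e E a₀ S : ℕ} (he : 1 ≤ e) (hE : e ≤ E)
    (hlo : ∀ a < a₀, (p : ℤ) ^ a * ((p : ℤ) - 1) < e) (hhi : (e : ℤ) ≤ (p : ℤ) ^ a₀ * ((p : ℤ) - 1))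
    (hloS : ∀ a < S, (p : ℤ) ^ a * ((p : ℤ) - 1) < E) (hhiS : (E : ℤ) ≤ (p : ℤ) ^ S * ((p : ℤ) - 1)) :
    (a₀ : ℝ) - (p : ℝ) ^ a₀ / e ≤ (S : ℝ) - (p : ℝ) ^ S / E := by
  have hp2 : (2 : ℝ) ≤ p := by exact_mod_cast hp.out.two_le
  have hp1 : (0 : ℝ) < (p : ℝ) - 1 := by linarith
  have hp0 : (0 : ℝ) < (p : ℝ) := by linarith
  have he0 : (0 : ℝ) < e := by exact_mod_cast he
  have hE0 : (0 : ℝ) < E := by exact_mod_cast (le_trans he hE)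
  have haS : a₀ ≤ S := turning_le_turning_of_le hE hlo hhiS
  rcases haS.eq_or_lt with heq | hlt
  · -- same cell: `p^S/E ≤ p^S/e`
    subst heq
    have hpow : (0 : ℝ) ≤ (p : ℝ) ^ a₀ := by positivity
    have h : (p : ℝ) ^ a₀ / E ≤ (p : ℝ) ^ a₀ / e :=
      div_le_div_of_nonneg_left hpow he0 (by exact_mod_cast hE)
    linarith
  · -- `a₀ < S`: `a₀ ≤ S - 1`, `p^{a₀}/e ≥ 1/(p-1)`, `p^S/E < p/(p-1)`
    have hS1 : 1 ≤ S := by omega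
    -- (1) `1/(p-1) ≤ p^{a₀}/e` from `e ≤ p^{a₀} (p-1)`
    have hhi' : (e : ℝ) ≤ (p : ℝ) ^ a₀ * ((p : ℝ) - 1) := by exact_mod_cast hhi
    have h1 : 1 / ((p : ℝ) - 1) ≤ (p : ℝ) ^ a₀ / e := by
      rw [div_le_div_iff₀ hp1 he0, one_mul]
      linarith
    -- (2) `p^S/E < p/(p-1)` from `p^{S-1} (p-1) < E`
    have hloS' := hloS (S - 1) (by omega)
    have hloS'' : (p : ℝ) ^ (S - 1) * ((p : ℝ) - 1) < E := by exact_mod_cast hloS'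
    have hpS : (p : ℝ) ^ S = (p : ℝ) ^ (S - 1) * p := by
      rw [← pow_succ]
      congr 1
      omega
    have h2 : (p : ℝ) ^ S / E < p / ((p : ℝ) - 1) := by
      rw [div_lt_div_iff₀ hE0 hp1, hpS]
      have hpos : (0 : ℝ) < (p : ℝ) ^ (S - 1) := by positivity
      nlinarith
    -- (3) assemble: `a₀ ≤ S - 1` as reals
    have h3 : (a₀ : ℝ) ≤ (S : ℝ) - 1 := by
      have : a₀ + 1 ≤ S := hlt
      have : ((a₀ + 1 : ℕ) : ℝ) ≤ S := by exact_mod_cast this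
      push_cast at this
      linarith
    -- `p/(p-1) = 1 + 1/(p-1)`
    have h4 : (p : ℝ) / ((p : ℝ) - 1) = 1 + 1 / ((p : ℝ) - 1) := by
      field_simp
      ring
    linarith

/-- **Uniform radius**: `p^{a₀ − p^{a₀}/e} ≤ p^{S − p^S/E}` for `1 ≤ e ≤ E` (the envelope radius of `UnitLogMaxNorm` in
`p`-power form is dominated by its value at the largest admissible ramification index).  Feeds the real parameter `r` of
`Summit.ABC.IUTFork.Thm311.Real.not_licence_settingPrVolSharp_of_explicitDepth_star_radius` uniformly in `e_w ≤ E`.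
[cite: NeukirchANT1999, Ch. II (5.5)] -/
theorem rpow_envelope_le_of_le {e E a₀ S : ℕ} (he : 1 ≤ e) (hE : e ≤ E)
    (hlo : ∀ a < a₀, (p : ℤ) ^ a * ((p : ℤ) - 1) < e) (hhi : (e : ℤ) ≤ (p : ℤ) ^ a₀ * ((p : ℤ) - 1))
    (hloS : ∀ a < S, (p : ℤ) ^ a * ((p : ℤ) - 1) < E) (hhiS : (E : ℤ) ≤ (p : ℤ) ^ S * ((p : ℤ) - 1)) :
    (p : ℝ) ^ ((a₀ : ℝ) - (p : ℝ) ^ a₀ / e) ≤ (p : ℝ) ^ ((S : ℝ) - (p : ℝ) ^ S / E) := by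
  have hp1 : (1 : ℝ) ≤ p := by exact_mod_cast hp.out.one_le
  exact Real.rpow_le_rpow_of_exponent_le hp1 (envelope_logExponent_le_of_le he hE hlo hhi hloS hhiS)

omit hp in
/-- **The envelope exponent in `p`-power form**: `−(p^{a₀} − e·a₀)/e = a₀ − p^{a₀}/e` (so `‖ϖ‖^{p^{a₀} − e·a₀} = p^{a₀ − p^{a₀}/e}`
when `‖ϖ‖ = p^{−1/e}`). [cite: NeukirchANT1999, Ch. II (5.5)] -/
theorem neg_envelope_div_eq {e a₀ : ℕ} (he : 1 ≤ e) :
    -(((p : ℝ) ^ a₀ - (e : ℝ) * a₀) / e) = (a₀ : ℝ) - (p : ℝ) ^ a₀ / e := by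
  have he0 : (e : ℝ) ≠ 0 := by
    have : (0 : ℝ) < e := by exact_mod_cast he
    exact this.ne'
  field_simp
  ring

end LogEnvelope

/-- **`a < 1/(p−2) + 1/e`** for [IUTchIV] Prop. 1.2's exponent `a = ⌈e/(p−2)⌉/e` at `p > 2` (`⌈x⌉ < x + 1`); the uniform form
`a ≤ 1/(p−2) + 1/e₀` for every `e ≥ e₀` follows.  (Tree: `logRadiusA_sub_one_div_le` gives the weaker `a − 1/e ≤ 4/p`.)
[cite: Mochizuki2012, IUTchIV Prop. 1.2 p. 10] -/
theorem logRadiusA_lt_inv_add_inv {p : ℕ} (hp : 2 < p) {e : ℕ} (he : 1 ≤ e) :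
    logRadiusA p e < 1 / ((p : ℝ) - 2) + 1 / e := by
  have he0 : (0 : ℝ) < e := by exact_mod_cast he
  have hp2 : (0 : ℝ) < (p : ℝ) - 2 := by
    have : (3 : ℝ) ≤ p := by exact_mod_cast hp
    linarith
  unfold logRadiusA
  rw [if_neg (by omega)]
  have hceil : (⌈(e : ℝ) / ((p : ℝ) - 2)⌉ : ℝ) < (e : ℝ) / ((p : ℝ) - 2) + 1 := Int.ceil_lt_add_one _
  calc (⌈(e : ℝ) / ((p : ℝ) - 2)⌉ : ℝ) / e < ((e : ℝ) / ((p : ℝ) - 2) + 1) / e :=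
        div_lt_div_of_pos_right hceil he0
    _ = 1 / ((p : ℝ) - 2) + 1 / e := by
        field_simp

end Literature.IUT.LogVolume

end
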